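import Literature.MathematicalPhysics.QuantumLattice.YangMillsHodgeDualHeat
import Literature.MathematicalPhysics.QuantumLattice.LatticeWilsonFlow
import Mathlib.Algebra.Order.Chebyshev
import HarnessLib

/-!
# Pointwise bound for the nonlinearity of the `u`-equation: `|∑ₐ⟨u_a, N_a⟩|² ≤ (256 ε/r)² |u|² |F|²`

QuantumLattice support file (everything proved; no definitions, no named facts) on the proof
path of `Literature.MathematicalPhysics.QuantumLattice.Waldron2019_yangMillsFlow_flatTorus`
(A. Waldron, Invent. math. 217 (2019)), §4.2 (the term `∫⟨Ω, α # α⟩ ≤ e f f₁` of (4.11)): at a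
point `x` with `‖x‖ = r` where `‖F(x)(v, w)‖ ≤ (ε/r²)‖v‖‖w‖`,

* `abs_lc4_le_one` — `|ε_{abcd}| ≤ 1`;
* `norm_hodgeNonlin_le` — `‖N_a(x)‖ ≤ 32 (ε/r) ∑_{c,d} ‖F(e_c, e_d)‖`;
* `sq_sum_inner_hodgeNonlin_le` —
  `(∑ₐ ⟨u_a, N_a⟩)² ≤ (256 ε/r)² (∑ₐ‖u_a‖²)(∑_{c,d}‖F_{cd}‖²)` (matrix coefficients, Frobenius
  inner product).

References: A. Waldron, Invent. math. 217 (2019), §4.2 [Waldron2019]; [folklore].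
-/

noncomputable section

open scoped RealInnerProductSpace Matrix.Norms.Frobenius BigOperators
open Literature.Analysis.InnerProduct

namespace Literature.MathematicalPhysics.QuantumLattice

attribute [local instance] frobeniusInnerProductSpace

variable {N : ℕ}
variable {E : Type*} [NormedAddCommGroup E] [InnerProductSpace ℝ E]

local notation "𝔤" => Matrix (Fin N) (Fin N) ℂ

/-- `−1 ≤ ε_{abcd} ≤ 1` (decided). [folklore] -/
theorem lc4_mem_Icc (a b c d : Fin 4) : -1 ≤ lc4 a b c d ∧ lc4 a b c d ≤ 1 := by
  revert a b c d; decide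

/-- `|ε_{abcd}| ≤ 1` as real numbers. [folklore] -/
theorem abs_lc4_le_one (a b c d : Fin 4) : |((lc4 a b c d : ℤ) : ℝ)| ≤ 1 := by
  obtain ⟨h1, h2⟩ := lc4_mem_Icc a b c d
  rw [abs_le]
  exact ⟨by exact_mod_cast h1, by exact_mod_cast h2⟩

/-- **Bound for the nonlinearity**: if `‖F(x)(v,w)‖ ≤ (ε/r²)‖v‖‖w‖` at `x` with `‖x‖ ≤ r`
(`r > 0`) then `‖N_a(x)‖ ≤ 32 (ε/r) ∑_{c,d} ‖F(x)(e_c, e_d)‖`. [folklore] -/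
theorem norm_hodgeNonlin_le (e : OrthonormalBasis (Fin 4) ℝ E) {B : Connection E 𝔤} {x : E}
    {r ε : ℝ} (hr : 0 < r) (hx : ‖x‖ ≤ r)
    (hF : ∀ v w : E, ‖curvature B x v w‖ ≤ ε / r ^ 2 * ‖v‖ * ‖w‖) (a : Fin 4) :
    ‖hodgeNonlin e B a x‖ ≤ 32 * (ε / r) * ∑ c, ∑ d, ‖curvature B x (e c) (e d)‖ := by
  have he : ∀ k, ‖e k‖ = 1 := fun k => e.orthonormal.1 k
  have hFb : ∀ c d, ‖curvature B x (e c) (e d)‖ ≤ ε / r ^ 2 := fun c d => by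
    have := hF (e c) (e d); rwa [he, he, mul_one, mul_one] at this
  have hxb : ∀ b, |⟪x, e b⟫| ≤ r := fun b =>
    ((abs_real_inner_le_norm x (e b)).trans (by rw [he, mul_one]; exact hx))
  -- the inner bracket sum
  have hbr : ∀ c d, ‖∑ i, ⁅curvature B x (e c) (e i), curvature B x (e i) (e d)⁆‖ ≤
      2 * (ε / r ^ 2) * ∑ d', ‖curvature B x (e d') (e d)‖ := by
    intro c d
    refine (norm_sum_le _ _).trans ?_
    rw [Finset.mul_sum]
    refine Finset.sum_le_sum fun i _ => ?_
    rw [Ring.lie_def]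
    calc ‖curvature B x (e c) (e i) * curvature B x (e i) (e d) - curvature B x (e i) (e d) * curvature B x (e c) (e i)‖
        ≤ ‖curvature B x (e c) (e i) * curvature B x (e i) (e d)‖ + ‖curvature B x (e i) (e d) * curvature B x (e c) (e i)‖ :=
          norm_sub_le _ _
      _ ≤ ‖curvature B x (e c) (e i)‖ * ‖curvature B x (e i) (e d)‖ + ‖curvature B x (e i) (e d)‖ * ‖curvature B x (e c) (e i)‖ :=
          add_le_add (norm_mul_le _ _) (norm_mul_le _ _)
      _ ≤ ε / r ^ 2 * ‖curvature B x (e i) (e d)‖ + ‖curvature B x (e i) (e d)‖ * (ε / r ^ 2) :=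
          add_le_add (mul_le_mul_of_nonneg_right (hFb c i) (norm_nonneg _))
            (mul_le_mul_of_nonneg_left (hFb c i) (norm_nonneg _))
      _ = 2 * (ε / r ^ 2) * ‖curvature B x (e i) (e d)‖ := by ring
  -- sum over `b, c, d`
  unfold hodgeNonlin
  calc ‖∑ b, ∑ c, ∑ d, (((lc4 a b c d : ℤ) : ℝ) * ⟪x, e b⟫) • ∑ i, ⁅curvature B x (e c) (e i), curvature B x (e i) (e d)⁆‖
      ≤ ∑ b, ∑ c, ∑ d, ‖(((lc4 a b c d : ℤ) : ℝ) * ⟪x, e b⟫) • ∑ i, ⁅curvature B x (e c) (e i), curvature B x (e i) (e d)⁆‖ := by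
        refine (norm_sum_le _ _).trans (Finset.sum_le_sum fun b _ => ?_)
        exact (norm_sum_le _ _).trans (Finset.sum_le_sum fun c _ => norm_sum_le _ _)
    _ ≤ ∑ b : Fin 4, ∑ c : Fin 4, ∑ d, r * (2 * (ε / r ^ 2) * ∑ d', ‖curvature B x (e d') (e d)‖) := by
        refine Finset.sum_le_sum fun b _ => Finset.sum_le_sum fun c _ => Finset.sum_le_sum fun d _ => ?_
        rw [norm_smul, Real.norm_eq_abs, abs_mul]
        refine mul_le_mul ?_ (hbr c d) (norm_nonneg _) hr.le
        calc |((lc4 a b c d : ℤ) : ℝ)| * |⟪x, e b⟫| ≤ 1 * r :=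
              mul_le_mul (abs_lc4_le_one a b c d) (hxb b) (abs_nonneg _) zero_le_one
          _ = r := one_mul r
    _ = 32 * (ε / r) * ∑ c, ∑ d, ‖curvature B x (e c) (e d)‖ := by
        have hX : ∑ d, r * (2 * (ε / r ^ 2) * ∑ d', ‖curvature B x (e d') (e d)‖) =
            2 * (ε / r) * ∑ c, ∑ d, ‖curvature B x (e c) (e d)‖ := by
          rw [← Finset.mul_sum, ← Finset.mul_sum, Finset.sum_comm]
          field_simp
        simp only [hX, Finset.sum_const, Finset.card_univ, Fintype.card_fin]
        simp only [nsmul_eq_mul]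
        push_cast
        ring

/-- **`(∑ₐ ⟨u_a, N_a⟩)² ≤ (256 ε/r)² (∑ₐ‖u_a‖²)(∑_{c,d}‖F_{cd}‖²)`** under the same hypotheses.
[folklore] -/
theorem sq_sum_inner_hodgeNonlin_le (e : OrthonormalBasis (Fin 4) ℝ E) {B : Connection E 𝔤} {x : E}
    {r ε : ℝ} (hr : 0 < r) (hx : ‖x‖ ≤ r)
    (hF : ∀ v w : E, ‖curvature B x v w‖ ≤ ε / r ^ 2 * ‖v‖ * ‖w‖) (u : Fin 4 → 𝔤) :
    (∑ a, ⟪u a, hodgeNonlin e B a x⟫) ^ 2 ≤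
      (256 * (ε / r)) ^ 2 * (∑ a, ‖u a‖ ^ 2) * ∑ c, ∑ d, ‖curvature B x (e c) (e d)‖ ^ 2 := by
  have hN := norm_hodgeNonlin_le e hr hx hF
  have hS0 : 0 ≤ ∑ c, ∑ d, ‖curvature B x (e c) (e d)‖ :=
    Finset.sum_nonneg fun c _ => Finset.sum_nonneg fun d _ => norm_nonneg _
  generalize hS : ∑ c, ∑ d, ‖curvature B x (e c) (e d)‖ = S at hN hS0
  -- `|∑⟨u_a, N_a⟩| ≤ 32 (ε/r) S ∑‖u_a‖`
  have h1 : |∑ a, ⟪u a, hodgeNonlin e B a x⟫| ≤ 32 * (ε / r) * S * ∑ a, ‖u a‖ := by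
    refine (Finset.abs_sum_le_sum_abs _ _).trans ?_
    rw [Finset.mul_sum]
    refine Finset.sum_le_sum fun a _ => ?_
    calc |⟪u a, hodgeNonlin e B a x⟫| ≤ ‖u a‖ * ‖hodgeNonlin e B a x‖ := abs_real_inner_le_norm _ _
      _ ≤ ‖u a‖ * (32 * (ε / r) * S) := mul_le_mul_of_nonneg_left (hN a) (norm_nonneg _)
      _ = 32 * (ε / r) * S * ‖u a‖ := by ring
  -- `S² ≤ 16 ∑∑‖F‖²` and `(∑‖u_a‖)² ≤ 4 ∑‖u_a‖²`
  have hS2 : S ^ 2 ≤ 16 * ∑ c, ∑ d, ‖curvature B x (e c) (e d)‖ ^ 2 := by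
    have h := sq_sum_le_card_mul_sum_sq (s := (Finset.univ : Finset (Fin 4 × Fin 4)))
      (f := fun p => ‖curvature B x (e p.1) (e p.2)‖)
    simp only [Finset.card_univ, Fintype.card_prod, Fintype.card_fin, Fintype.sum_prod_type] at h
    norm_num at h
    rw [← hS]
    exact h
  have hu2 : (∑ a, ‖u a‖) ^ 2 ≤ 4 * ∑ a, ‖u a‖ ^ 2 := by
    have h := sq_sum_le_card_mul_sum_sq (s := (Finset.univ : Finset (Fin 4))) (f := fun a => ‖u a‖)
    simpa using h
  calc (∑ a, ⟪u a, hodgeNonlin e B a x⟫) ^ 2 ≤ (32 * (ε / r) * S * ∑ a, ‖u a‖) ^ 2 :=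
        sq_le_sq' (abs_le.1 h1).1 (abs_le.1 h1).2
    _ = (32 * (ε / r)) ^ 2 * (∑ a, ‖u a‖) ^ 2 * S ^ 2 := by ring
    _ ≤ (32 * (ε / r)) ^ 2 * (4 * ∑ a, ‖u a‖ ^ 2) * (16 * ∑ c, ∑ d, ‖curvature B x (e c) (e d)‖ ^ 2) := by
        have hA : 0 ≤ (32 * (ε / r)) ^ 2 := sq_nonneg _
        have hB : 0 ≤ (∑ a, ‖u a‖) ^ 2 := sq_nonneg _
        exact mul_le_mul (mul_le_mul_of_nonneg_left hu2 hA) hS2 (sq_nonneg _) (by positivity)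
    _ = (256 * (ε / r)) ^ 2 * (∑ a, ‖u a‖ ^ 2) * ∑ c, ∑ d, ‖curvature B x (e c) (e d)‖ ^ 2 := by ring

end Literature.MathematicalPhysics.QuantumLattice
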